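import Mathlib
import HarnessLib
import Literature.MathematicalPhysics.QuantumLattice.HubbardSectorGridOverlapReindex
import Literature.MathematicalPhysics.QuantumLattice.HubbardGridCharacters
import Summits.HubbardSuperconductivity.HubbardSuperconductivity.Theorems.KLProgrammeKLRegimeTorusL1SecondDifferences
import Summits.HubbardSuperconductivity.HubbardSuperconductivity.Theorems.KLProgrammeKLRegimeEngineScaleZeroNorms

/-!
# K3 engine child, stub `stub_engine_scale0`, clause (E1-v4)₀: the sizes `Br`, `Bc` of the cross-grid overlap kernel `E_F S_{4M}`
# from the SUP, the SUPPORT COUNT and the single-direction SECOND DIFFERENCES of the multiplier symbol (the scale-`0` "sector lemma",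
# Plancherel half)

Cell gate-hubbard-kl, seat hubbard-kl-k3c2-p1 (row «scale-0 Gram step `stub_engine_scale0`»).  Continuation of
`KLProgrammeKLRegimeEngineScaleZeroNorms` (the (E1-v4)₀ assembly modulo the three sizes `α`, `Br`, `Bc`) and of
`Literature/…/HubbardSectorGridOverlapReindex` (`Br`, `Bc` from ONE bound `T` on the product-torus `ℓ¹` sum
`(|β|L²)⁻¹ Σ_{(d,w) ∈ (ℤ/4M)×(ℤ/L)²} ‖Σ_k F_ω(k) χ_{k₀}(d) χ_{k⃗}(w)‖`).  Here `T` is produced from symbol data by the ADDITIVE-weight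
`ℓ²` route of k3c2-p3's master lemma `TorusFourierL2.sum_norm_charSum_le_of_second_differences` (Cauchy–Schwarz with the quartic weight,
Plancherel with second forward differences, p5's `sum_inv_additiveWeight_le`; Benfatto–Giuliani–Mastropietro 2006, (2.71a)/(2.81) with
footnote ¹ at finite `(β, L)`):

* `charSum_freqMomentum_eq_charSum_padded` — the frequency–momentum character sum is the product-torus character sum of the symbol
  PADDED by zero to `(ℤ/4M) × (ℤ/L)²` (`HubbardGridCharacters.sum_freqMomentum_eq_sum_gridTorus`);
* `norm_charSum_conj_eq` — for a REAL multiplier family the `ψ⁻`-orientation (`c = 1`, conjugate characters) has the same size;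
* **`torusSum_le_of_symbol_bounds`** — if `‖F_ω‖ ≤ 1`, the padded symbol has support `≤ N_s`, time second differences
  `≤ (4/(s₀·4M))²` and axis second differences `≤ (4/(s₁L))²` (pointwise), then for every sector `ω` and charge `c`
  `(|β|L²)⁻¹ Σ_{(d,w)} ‖Σ_k F_ω(k) Χ_c(k; d, w)‖ ≤ (|β|L²)⁻¹ · √(2048(1/s₀+1)[4(2√2/s₁+2)² + 16(1/s₁+1)²]) · √(16·4M·L²·N_s)`;
* **`klAnisoLegKernelNorm_zero_le_of_symbol_bounds`** — (E1-v4)₀'s norm bound with `Br`, `Bc` DISCHARGED by the symbol data of the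
  scale-`0` family `klAnisoFamily … klE0 0` (two sectors: `Bc = 2·Br`), leaving the decay constant `α` of `Sᵀ C^K_{>e₀} S` and the three
  symbol numbers `(N_s, s₀, s₁)` as the only inputs.

With `N_s ≍ (e₀β)(e₀L²)`, `s₀ ≍ βe₀/M`, `s₁ ≍ e₀` (the scale-`0` multiplier varies on the frequency scale `e₀` and the momentum scale
`≍ e₀`; FrameOK (i) gives the `C²` band data) the bound reads `T ≲ (4M/β)·e₀^{-3/2}·const`, i.e. `Br·β/(4M)`, `Bc·β/(2M)` are ABSOLUTE —
the symbol numbers themselves are the business of the symbol-layer file (sup/support/second differences of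
`gnCutoff(√(ν²+e_K²))·ζ_ω(θ(k⃗))` on a frame).

Everything is proved; no definitions, no named facts, no sorry.
-/

noncomputable section

namespace Summit.HubbardSuperconductivity.HubbardSuperconductivity.Theorems.EngineV8

set_option linter.dupNamespace false -- summit = problem name (single-conjunct summit), D-0017

open Real Finset Literature.MathematicalPhysics.QuantumLattice Literature.Probability.LatticeModels
open Summit.HubbardSuperconductivity.HubbardSuperconductivity.Theorems.KLRegimeSplit
open Summit.HubbardSuperconductivity.HubbardSuperconductivity.Theorems.DispersionFlow
open Summit.HubbardSuperconductivity.HubbardSuperconductivity.Theorems.KLProgrammeLegKernels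
open Summit.HubbardSuperconductivity.HubbardSuperconductivity.Theorems.TorusFourierL2
open scoped ComplexConjugate

variable {L M : ℕ} [NeZero L] {Ns : ℕ}

/-! ## §1 The frequency–momentum character sum as a padded product-torus character sum -/

/-- **Padding to the product torus**: `Σ_{k=(i,k⃗)} F_ω(k) χ_i(d) χ_{k⃗}(w) = Σ_{q ∈ (ℤ/4M)×(ℤ/L)²} (χ_{q₁}(d) χ_{q₂}(w)) • G_ω(q)` with
`G_ω(q) = F_ω(⟨val q₁⟩, q₂)` for `val q₁ < 2M` and `0` beyond. -/
theorem charSum_freqMomentum_eq_charSum_padded [NeZero M] (F : Fin Ns → FreqMomentum L M → ℂ) (ω : Fin Ns)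
    (d : TorusSite 1 (2 * (2 * M))) (w : TorusSite 2 L) :
    ∑ k : FreqMomentum L M, F ω k *
        (torusChar (fun _ : Fin 1 => ((k.1 : ℕ) : ZMod (2 * (2 * M)))) d * torusChar k.2 w) =
      ∑ q : TorusSite 1 (2 * (2 * M)) × TorusSite 2 L, (torusChar q.1 d * torusChar q.2 w) •
        (fun q : TorusSite 1 (2 * (2 * M)) × TorusSite 2 L =>
          if h : (q.1 0).val < 2 * M then F ω (⟨(q.1 0).val, h⟩, q.2) else 0) q := by
  haveI : NeZero (2 * (2 * M)) := ⟨by have := NeZero.ne M; omega⟩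
  rw [sum_freqMomentum_eq_sum_gridTorus (L := L) (M := M) (N := 2 * (2 * M)) (by omega), Fintype.sum_prod_type]
  refine sum_congr rfl fun q₀ _ => sum_congr rfl fun qv _ => ?_
  dsimp only
  split_ifs with h
  · have hq' : torusChar (fun _ : Fin 1 => ((((⟨(q₀ 0).val, h⟩ : MatsubaraIdx M) : ℕ) : ZMod (2 * (2 * M))))) d = torusChar q₀ d := by
      have hq : ((fun _ : Fin 1 => ((((⟨(q₀ 0).val, h⟩ : MatsubaraIdx M) : ℕ) : ZMod (2 * (2 * M))))) :
          TorusSite 1 (2 * (2 * M))) = q₀ := by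
        funext j
        rw [Subsingleton.elim j 0]
        exact ZMod.natCast_zmod_val (q₀ 0)
      exact congrArg (fun a : TorusSite 1 (2 * (2 * M)) => torusChar a d) hq
    rw [hq', smul_eq_mul, mul_comm]
  · rw [smul_zero]

/-- **For a real multiplier family the conjugate-character sum has the same size**:
`‖Σ_k F_ω(k) conj(χ_{k₀}(d)χ_{k⃗}(w))‖ = ‖Σ_k F_ω(k) χ_{k₀}(d)χ_{k⃗}(w)‖` when `conj F_ω(k) = F_ω(k)`. -/
theorem norm_charSum_conj_eq [NeZero M] (F : Fin Ns → FreqMomentum L M → ℂ) (hreal : ∀ ω k, conj (F ω k) = F ω k) (ω : Fin Ns)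
    (d : TorusSite 1 (2 * (2 * M))) (w : TorusSite 2 L) :
    ‖∑ k : FreqMomentum L M, F ω k *
        conj (torusChar (fun _ : Fin 1 => ((k.1 : ℕ) : ZMod (2 * (2 * M)))) d * torusChar k.2 w)‖ =
      ‖∑ k : FreqMomentum L M, F ω k *
        (torusChar (fun _ : Fin 1 => ((k.1 : ℕ) : ZMod (2 * (2 * M)))) d * torusChar k.2 w)‖ := by
  rw [← Complex.norm_conj (∑ k : FreqMomentum L M, F ω k *
        (torusChar (fun _ : Fin 1 => ((k.1 : ℕ) : ZMod (2 * (2 * M)))) d * torusChar k.2 w)), map_sum]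
  refine congrArg _ (sum_congr rfl fun k _ => ?_)
  rw [map_mul (starRingEnd ℂ) (F ω k), hreal]

/-! ## §2 The product-torus `ℓ¹` sum from symbol data -/

/-- **The product-torus `ℓ¹` sum from the sup, the support count and the second differences of the padded symbol** (BGM 2006 (2.71a),
the scale-`0` "sector lemma", Plancherel half): for a real multiplier family `F` with `‖F_ω‖ ≤ 1` whose padded symbol `G_ω` on
`(ℤ/4M) × (ℤ/L)²` has at most `N_s` nonzero values, time second differences `≤ (4/(s₀·4M))²` and axis second differences `≤ (4/(s₁L))²`,
`(|β|L²)⁻¹ Σ_{(d,w)} ‖Σ_k F_ω(k) Χ_c(k; d, w)‖ ≤ (|β|L²)⁻¹ · √(2048(1/s₀+1)[4(2√2/s₁+2)² + 16(1/s₁+1)²]) · √(16·4M·L²·N_s)` for every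
`ω`, `c`. -/
theorem torusSum_le_of_symbol_bounds [NeZero M] (β : ℝ) (F : Fin Ns → FreqMomentum L M → ℂ)
    (hreal : ∀ ω k, conj (F ω k) = F ω k) (hF1 : ∀ ω k, ‖F ω k‖ ≤ 1)
    {s₀ s₁ : ℝ} (hs₀ : 0 < s₀) (hs₁ : 0 < s₁) {Nsupp : ℕ}
    (hsupp : ∀ ω, (univ.filter fun q : TorusSite 1 (2 * (2 * M)) × TorusSite 2 L =>
      (if h : (q.1 0).val < 2 * M then F ω (⟨(q.1 0).val, h⟩, q.2) else 0) ≠ 0).card ≤ Nsupp)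
    (h₀ : ∀ ω q, ‖(fwdDiff ((fun _ : Fin 1 => (1 : ZMod (2 * (2 * M)))), (0 : TorusSite 2 L)))^[2]
      (fun q : TorusSite 1 (2 * (2 * M)) × TorusSite 2 L =>
        if h : (q.1 0).val < 2 * M then F ω (⟨(q.1 0).val, h⟩, q.2) else 0) q‖ ≤ (4 / (s₀ * (2 * (2 * M) : ℕ))) ^ 2)
    (h₁ : ∀ ω q (i : Fin 2), ‖(fwdDiff ((0 : TorusSite 1 (2 * (2 * M))), (Pi.single i (1 : ZMod L) : TorusSite 2 L)))^[2]
      (fun q : TorusSite 1 (2 * (2 * M)) × TorusSite 2 L =>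
        if h : (q.1 0).val < 2 * M then F ω (⟨(q.1 0).val, h⟩, q.2) else 0) q‖ ≤ (4 / (s₁ * L)) ^ 2)
    (ω : Fin Ns) (c : Fin 2) :
    1 / (|β| * (L : ℝ) ^ 2) *
        ∑ dw : TorusSite 1 (2 * (2 * M)) × TorusSite 2 L, ‖∑ k : FreqMomentum L M, F ω k *
          (if c = 0 then torusChar (fun _ : Fin 1 => ((k.1 : ℕ) : ZMod (2 * (2 * M)))) dw.1 * torusChar k.2 dw.2
            else conj (torusChar (fun _ : Fin 1 => ((k.1 : ℕ) : ZMod (2 * (2 * M)))) dw.1 * torusChar k.2 dw.2))‖ ≤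
      1 / (|β| * (L : ℝ) ^ 2) *
        (Real.sqrt (2048 * (1 / s₀ + 1) *
            (4 * ((2 * Real.sqrt 2 / s₁ + 2) * (2 * Real.sqrt 2 / s₁ + 2)) + 16 * (1 / s₁ + 1) ^ 2)) *
          Real.sqrt (16 * (2 * (2 * M) : ℕ) * (L : ℝ) ^ 2 * Nsupp)) := by
  classical
  haveI : NeZero (2 * (2 * M)) := ⟨by have := NeZero.ne M; omega⟩
  refine mul_le_mul_of_nonneg_left ?_ (by positivity)
  -- reduce the conjugate orientation to the direct one
  have hc : ∀ dw : TorusSite 1 (2 * (2 * M)) × TorusSite 2 L, ‖∑ k : FreqMomentum L M, F ω k *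
      (if c = 0 then torusChar (fun _ : Fin 1 => ((k.1 : ℕ) : ZMod (2 * (2 * M)))) dw.1 * torusChar k.2 dw.2
        else conj (torusChar (fun _ : Fin 1 => ((k.1 : ℕ) : ZMod (2 * (2 * M)))) dw.1 * torusChar k.2 dw.2))‖ =
      ‖∑ k : FreqMomentum L M, F ω k *
        (torusChar (fun _ : Fin 1 => ((k.1 : ℕ) : ZMod (2 * (2 * M)))) dw.1 * torusChar k.2 dw.2)‖ := by
    intro dw
    by_cases hc0 : c = 0
    · simp only [hc0, if_true]
    · simp only [hc0, if_false]
      exact norm_charSum_conj_eq F hreal ω dw.1 dw.2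
  simp_rw [hc, charSum_freqMomentum_eq_charSum_padded F ω]
  -- the padded symbol
  set G : TorusSite 1 (2 * (2 * M)) × TorusSite 2 L → ℂ := fun q =>
    if h : (q.1 0).val < 2 * M then F ω (⟨(q.1 0).val, h⟩, q.2) else 0 with hG
  have hsup : ∀ q, ‖G q‖ ≤ 1 := fun q => by
    rw [hG]
    dsimp only
    split_ifs
    · exact hF1 ω _
    · rw [norm_zero]; exact zero_le_one
  -- the master lemma with `v = e₁` (so `v⊥ = e₂`), near radius `0`, `A₀ = 1`
  have hL : (0 : ℤ) < L := by exact_mod_cast Nat.pos_of_ne_zero (NeZero.ne L)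
  have hv : (![1, 0] : Fin 2 → ℤ) ≠ 0 := fun h => by simpa using congr_fun h 0
  have hR₀ : 2 * (|(![1, 0] : Fin 2 → ℤ) 0| + |(![1, 0] : Fin 2 → ℤ) 1|) * ((0 : ℕ) : ℤ) < L := by simpa using hL
  have hdir2 : (fun j : Fin 2 => (((![-(![1, 0] : Fin 2 → ℤ) 1, (![1, 0] : Fin 2 → ℤ) 0] : Fin 2 → ℤ) j : ℤ) : ZMod L)) =
      (Pi.single 1 (1 : ZMod L) : TorusSite 2 L) := by
    funext j
    fin_cases j <;> simp
  have hdir3 : (fun j : Fin 2 => (((![1, 0] : Fin 2 → ℤ) j : ℤ) : ZMod L)) = (Pi.single 0 (1 : ZMod L) : TorusSite 2 L) := by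
    funext j
    fin_cases j <;> simp
  have hmain := sum_norm_charSum_le_of_second_differences G (![1, 0]) hv hs₀ hs₁ hs₁ hs₁ (R₀ := 0) hR₀ zero_le_one (hsupp ω) hsup
    (fun q => by rw [one_mul]; exact h₀ ω q)
    (fun q i => by rw [one_mul]; exact h₁ ω q i)
    (fun q => by rw [one_mul, hdir2]; exact h₁ ω q 1)
    (fun q => by rw [one_mul, hdir3]; exact h₁ ω q 0)
  have hnorm : Real.sqrt (((![1, 0] : Fin 2 → ℤ) 0 : ℝ) ^ 2 + ((![1, 0] : Fin 2 → ℤ) 1 : ℝ) ^ 2) = 1 := by simp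
  simp only [hnorm, mul_one, Nat.cast_zero, mul_zero, add_zero, div_one] at hmain
  convert hmain using 2

/-! ## §3 (E1-v4)₀ with `Br`, `Bc` discharged by the symbol data of the scale-`0` family -/

omit [NeZero L] in
/-- The anisotropic multipliers are real: `conj F_ω(k) = F_ω(k)`. -/
theorem conj_klAnisoFamily (β μ : ℝ) (K : TrigPolyC4v) (e₀ : ℝ) (n : ℕ) (ω : Fin (sectorCount n)) (k : FreqMomentum L M) :
    conj (klAnisoFamily L M β μ K e₀ n ω k) = klAnisoFamily L M β μ K e₀ n ω k := by
  rw [klAnisoFamily, bgmMultiplier]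
  exact Complex.conj_ofReal _

/-- There are two anisotropic sectors at scale `0`. -/
theorem sectorCount_zero : sectorCount 0 = 2 := by
  simp [sectorCount]

/-- **(E1-v4)₀ modulo the decay constant and three symbol numbers**: for every admissible frame (`FrameOK R U N μ K`, `klBetaMin ≤ β ≤ L`),
if the pulled-back scale-`0` covariance has row/column sums `≤ α` with `θ = eα‖Ṽ‖_h/κ₀² < 1`, and the padded scale-`0` multiplier symbols
`G_ω` (`ω` a sector of `klAnisoFamily … klE0 0`) have support `≤ N_s`, time second differences `≤ (4/(s₀·4M))²` and axis second differences
`≤ (4/(s₁L))²`, then for every `p ≥ 2`, with `T := (|β|L²)⁻¹ √(2048(1/s₀+1)[4(2√2/s₁+2)² + 16(1/s₁+1)²]) √(16·4M·L²·N_s)`,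
`klAnisoLegKernelNorm … klE0 0 (2p) ≤ T · (2T)^{2p-1} · (β/(2M))^{2p-1} · (κ₀^{-2p} e‖Ṽ‖_h θ^{p-2}/(1-θ))`. -/
theorem klAnisoLegKernelNorm_zero_le_of_symbol_bounds [NeZero M] {R : RenConsts} {U : ℝ} {N : ℕ} {μ : ℝ} {K : TrigPolyC4v}
    (hK : FrameOK R U N μ K) {β : ℝ} (hβ : klBetaMin ≤ β) (hβL : β ≤ L)
    {α : ℝ} (hα : 0 < α)
    (hrow : ∀ X, ∑ Y, ‖((hubbardGridSub L M β (2 * (2 * M))).transpose * hubbardCovAboveCT L M β μ 0 K klE0 *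
      hubbardGridSub L M β (2 * (2 * M))) X Y‖ ≤ α)
    (hcol : ∀ Y, ∑ X, ‖((hubbardGridSub L M β (2 * (2 * M))).transpose * hubbardCovAboveCT L M β μ 0 K klE0 *
      hubbardGridSub L M β (2 * (2 * M))) X Y‖ ≤ α)
    (hθ : Real.exp 1 * α * normV (GridLeg (GridPoint L (2 * (2 * M)))) (Real.sqrt (2 * (7 + 6047))) (Real.sqrt (2 * (7 + 6047)))
      (fun m' : ℕ => if m' = 1 then |β| / (2 * (2 * M) : ℕ) * K.coeffNorm 0 else if m' = 2 then |U| * |β| / (2 * (2 * M) : ℕ) else 0) /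
        Real.sqrt (2 * (7 + 6047)) ^ 2 < 1)
    {s₀ s₁ : ℝ} (hs₀ : 0 < s₀) (hs₁ : 0 < s₁) {Nsupp : ℕ}
    (hsupp : ∀ ω : Fin (sectorCount 0), (univ.filter fun q : TorusSite 1 (2 * (2 * M)) × TorusSite 2 L =>
      (if h : (q.1 0).val < 2 * M then klAnisoFamily L M β μ K klE0 0 ω (⟨(q.1 0).val, h⟩, q.2) else 0) ≠ 0).card ≤ Nsupp)
    (h₀ : ∀ (ω : Fin (sectorCount 0)) q, ‖(fwdDiff ((fun _ : Fin 1 => (1 : ZMod (2 * (2 * M)))), (0 : TorusSite 2 L)))^[2]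
      (fun q : TorusSite 1 (2 * (2 * M)) × TorusSite 2 L =>
        if h : (q.1 0).val < 2 * M then klAnisoFamily L M β μ K klE0 0 ω (⟨(q.1 0).val, h⟩, q.2) else 0) q‖ ≤
          (4 / (s₀ * (2 * (2 * M) : ℕ))) ^ 2)
    (h₁ : ∀ (ω : Fin (sectorCount 0)) q (i : Fin 2),
      ‖(fwdDiff ((0 : TorusSite 1 (2 * (2 * M))), (Pi.single i (1 : ZMod L) : TorusSite 2 L)))^[2]
        (fun q : TorusSite 1 (2 * (2 * M)) × TorusSite 2 L =>
          if h : (q.1 0).val < 2 * M then klAnisoFamily L M β μ K klE0 0 ω (⟨(q.1 0).val, h⟩, q.2) else 0) q‖ ≤ (4 / (s₁ * L)) ^ 2)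
    {p : ℕ} (hp : 2 ≤ p) :
    klAnisoLegKernelNorm L M β U μ K klE0 0 (2 * p) ≤
      (1 / (|β| * (L : ℝ) ^ 2) *
        (Real.sqrt (2048 * (1 / s₀ + 1) *
            (4 * ((2 * Real.sqrt 2 / s₁ + 2) * (2 * Real.sqrt 2 / s₁ + 2)) + 16 * (1 / s₁ + 1) ^ 2)) *
          Real.sqrt (16 * (2 * (2 * M) : ℕ) * (L : ℝ) ^ 2 * Nsupp))) *
      (2 * (1 / (|β| * (L : ℝ) ^ 2) *
        (Real.sqrt (2048 * (1 / s₀ + 1) *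
            (4 * ((2 * Real.sqrt 2 / s₁ + 2) * (2 * Real.sqrt 2 / s₁ + 2)) + 16 * (1 / s₁ + 1) ^ 2)) *
          Real.sqrt (16 * (2 * (2 * M) : ℕ) * (L : ℝ) ^ 2 * Nsupp)))) ^ (2 * p - 1) *
      imagTimeWeight β M ^ (2 * p - 1) *
        ((Real.sqrt (2 * (7 + 6047)))⁻¹ ^ (2 * p) *
          (Real.exp 1 * normV (GridLeg (GridPoint L (2 * (2 * M)))) (Real.sqrt (2 * (7 + 6047))) (Real.sqrt (2 * (7 + 6047)))
            (fun m' : ℕ => if m' = 1 then |β| / (2 * (2 * M) : ℕ) * K.coeffNorm 0 else if m' = 2 then |U| * |β| / (2 * (2 * M) : ℕ) else 0)) *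
          (Real.exp 1 * α * normV (GridLeg (GridPoint L (2 * (2 * M)))) (Real.sqrt (2 * (7 + 6047))) (Real.sqrt (2 * (7 + 6047)))
            (fun m' : ℕ => if m' = 1 then |β| / (2 * (2 * M) : ℕ) * K.coeffNorm 0 else if m' = 2 then |U| * |β| / (2 * (2 * M) : ℕ) else 0) /
              Real.sqrt (2 * (7 + 6047)) ^ 2) ^ (p - 2) /
          (1 - Real.exp 1 * α * normV (GridLeg (GridPoint L (2 * (2 * M)))) (Real.sqrt (2 * (7 + 6047))) (Real.sqrt (2 * (7 + 6047)))
            (fun m' : ℕ => if m' = 1 then |β| / (2 * (2 * M) : ℕ) * K.coeffNorm 0 else if m' = 2 then |U| * |β| / (2 * (2 * M) : ℕ) else 0) /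
              Real.sqrt (2 * (7 + 6047)) ^ 2)) := by
  have hβpos : 0 < β := lt_of_lt_of_le (by norm_num [klBetaMin]) hβ
  set T : ℝ := 1 / (|β| * (L : ℝ) ^ 2) *
        (Real.sqrt (2048 * (1 / s₀ + 1) *
            (4 * ((2 * Real.sqrt 2 / s₁ + 2) * (2 * Real.sqrt 2 / s₁ + 2)) + 16 * (1 / s₁ + 1) ^ 2)) *
          Real.sqrt (16 * (2 * (2 * M) : ℕ) * (L : ℝ) ^ 2 * Nsupp)) with hT
  have hT0 : 0 ≤ T := by rw [hT]; positivity
  -- the product-torus bound for the scale-0 family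
  have htorus := torusSum_le_of_symbol_bounds β (klAnisoFamily L M β μ K klE0 0) (conj_klAnisoFamily β μ K klE0 0)
    (fun ω k => norm_bgmMultiplier_le_one klE0 β _ 0 ω k) hs₀ hs₁ hsupp h₀ h₁
  have hBr := rowSum_sectorAnalysis_mul_hubbardGridSub_le_of_torusSum hβpos.ne' (klAnisoFamily L M β μ K klE0 0) (T := T) htorus
  have hBc := colSum_sectorAnalysis_mul_hubbardGridSub_le_of_torusSum hβpos.ne' (klAnisoFamily L M β μ K klE0 0) (T := T) htorus
  have h2T : ((sectorCount 0 : ℕ) : ℝ) * T = 2 * T := by rw [sectorCount_zero]; norm_num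
  rw [h2T] at hBc
  exact klAnisoLegKernelNorm_zero_le_of_frameOK hK hβ hβL hα hrow hcol hθ hT0 (by positivity)
    (fun ω σ c y => hBr ω σ c y) (fun σ c q => hBc σ c q) hp

end Summit.HubbardSuperconductivity.HubbardSuperconductivity.Theorems.EngineV8

end
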